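import Summits.Ventures.PercRepro.Night2LocalRuleRows

/-!
# PercRepro — the distance-2 rule at `|E ∖ G| = q`: the loss bound and the residual capacity (night-2, gen 8)

Two of the five lemmas of Theorem E (`proofs/NIGHT-2-local.md` §17(k)), the local form at the flats with
`d = |E ∖ G| = q`:

* **`loss_le_dq`** ((k2)): at `d = q` every member outside layer 0 requests at most `1/(q+1)` per covering set,
  a covering set `S` with `k1 S` layer-0 preimages has at most `q + 1 − k1 S` other preimages, and the loss of a
  member at `S` is at most `k1 S / ((q+1)² (q+1−k1 S))`;
* **`cap2_ge_dq`** ((k4)): at `d = q` the residual capacity of any set `S` is at least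
  `((q+1)(q+1−κ₀(S)) − k1 S)/(q+1)²`, `κ₀(S)` the number of coloops of `S`.

The remaining ingredients of Theorem E — the count of the pairs carrying layer-2 weight at `S` by the series classes
of `M|S` ((k3)) and the concave inequality ((k5)) — are on paper.
-/

namespace PercRepro.Shadow

open Finset PerFlat ThmH

variable {α : Type*} [DecidableEq α] {M : Matroid α} [M.Finite]

omit [DecidableEq α] [M.Finite] in
/-- `Φ/(q+2) = 1/(q+1)`. -/
theorem phiQ_div_add_two (q : ℕ) : phiQ q / ((q : ℚ) + 2) = 1 / ((q : ℚ) + 1) := by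
  unfold phiQ
  have h1 : (0 : ℚ) < (q : ℚ) + 1 := by positivity
  have h2 : (0 : ℚ) < (q : ℚ) + 2 := by positivity
  field_simp

open scoped Classical in
/-- At `d = q` a member outside layer 0 requests at most `1/(q+1)`. -/
theorem req_le_dq {q : ℕ} {G : Finset α} (hG : G ∈ flatsQ M (q + 1)) (hd : (gr M \ G).card = q)
    {B : Finset α} (hB : B ∈ membersIn M (Uq M (q + 2) q) G) (hB0 : B ∉ lay0 M q G) :
    req M q B ≤ 1 / ((q : ℚ) + 1) := by
  have hm := two_le_card_sdiff_of_not_lay0 hG hd.le hB hB0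
  have hBG : clF M B ⊆ G := (mem_membersIn.1 hB).2
  have hc : (gr M \ clF M B).card = (G \ clF M B).card + q := by rw [card_compl_clF_add hG hBG, hd]
  unfold req
  rw [← phiQ_div_add_two]
  apply div_le_div_of_nonneg_left (phiQ_pos q).le (by positivity)
  rw [hc]; push_cast
  have : (2 : ℚ) ≤ ((G \ clF M B).card : ℚ) := by exact_mod_cast hm
  linarith

open scoped Classical in
/-- The covering preimages of a shadow set `S` split into the `k1 S` layer-0 ones and at most `q + 1 − k1 S`
others. -/
theorem card_thin_preimages_le {q : ℕ} {G S : Finset α} (hS : S ∈ shadowAt M (q + 2) q (Uq M (q + 2) q) G) :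
    ((coverPreimages M (Uq M (q + 2) q) G S).filter (fun B => B ∉ lay0 M q G)).card + k1 M q G S ≤ q + 1 := by
  unfold k1
  rw [add_comm, Finset.card_filter_add_card_filter_not]
  exact card_coverPreimages_le (Finset.Subset.refl _) hS

open scoped Classical in
/-- At `d = q`, `L1 S ≤ (q + 1 − k1 S)/(q + 1)` at every shadow set. -/
theorem L1_le_dq {q : ℕ} {G : Finset α} (hG : G ∈ flatsQ M (q + 1)) (hd : (gr M \ G).card = q)
    {S : Finset α} (hS : S ∈ shadowAt M (q + 2) q (Uq M (q + 2) q) G) :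
    L1 M q G S ≤ (((q : ℚ) + 1) - (k1 M q G S : ℚ)) / ((q : ℚ) + 1) := by
  unfold L1
  have hle : ∀ B ∈ (coverPreimages M (Uq M (q + 2) q) G S).filter (fun B => B ∉ lay0 M q G),
      req M q B ≤ 1 / ((q : ℚ) + 1) := by
    intro B hB
    rw [Finset.mem_filter, mem_coverPreimages] at hB
    exact req_le_dq hG hd hB.1.1 hB.2
  calc ∑ B ∈ (coverPreimages M (Uq M (q + 2) q) G S).filter (fun B => B ∉ lay0 M q G), req M q B
      ≤ ∑ _B ∈ (coverPreimages M (Uq M (q + 2) q) G S).filter (fun B => B ∉ lay0 M q G),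
          (1 : ℚ) / ((q : ℚ) + 1) := Finset.sum_le_sum hle
    _ = (((coverPreimages M (Uq M (q + 2) q) G S).filter (fun B => B ∉ lay0 M q G)).card : ℚ) *
          (1 / ((q : ℚ) + 1)) := by rw [Finset.sum_const, nsmul_eq_mul]
    _ ≤ (((q : ℚ) + 1) - (k1 M q G S : ℚ)) * (1 / ((q : ℚ) + 1)) := by
        apply mul_le_mul_of_nonneg_right _ (by positivity)
        have := card_thin_preimages_le hS
        have h' : (((coverPreimages M (Uq M (q + 2) q) G S).filter (fun B => B ∉ lay0 M q G)).card : ℚ) +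
            (k1 M q G S : ℚ) ≤ (q : ℚ) + 1 := by exact_mod_cast this
        linarith
    _ = (((q : ℚ) + 1) - (k1 M q G S : ℚ)) / ((q : ℚ) + 1) := by ring

omit [DecidableEq α] [M.Finite] in
/-- `(L − c)/L ≤ (L' − c)/L'` for `0 ≤ c`, `0 < L ≤ L'`. -/
theorem ratio_mono {c L L' : ℚ} (hc : 0 ≤ c) (hL : 0 < L) (hLL : L ≤ L') :
    (L - c) / L ≤ (L' - c) / L' := by
  have hL' : 0 < L' := hL.trans_le hLL
  rw [div_le_div_iff₀ hL hL']
  nlinarith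

omit [DecidableEq α] [M.Finite] in
/-- The arithmetic of (k2): `(1/(q+1)) · (L_max − cap)/L_max = k/((q+1)²(q+1−k))`. -/
theorem loss_arith {q k : ℕ} (hk : k ≤ q) :
    (1 / ((q : ℚ) + 1)) *
      (((((q : ℚ) + 1) - (k : ℚ)) / ((q : ℚ) + 1)) - (1 - (k : ℚ) * phiQ q / (1 + (q : ℚ)))) /
        ((((q : ℚ) + 1) - (k : ℚ)) / ((q : ℚ) + 1)) =
      (k : ℚ) / ((((q : ℚ) + 1) ^ 2) * (((q : ℚ) + 1) - (k : ℚ))) := by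
  unfold phiQ
  have hq : (0 : ℚ) < (q : ℚ) + 1 := by positivity
  have hqk : (0 : ℚ) < ((q : ℚ) + 1) - (k : ℚ) := by
    have : (k : ℚ) ≤ (q : ℚ) := by exact_mod_cast hk
    linarith
  have h1q : (1 : ℚ) + (q : ℚ) = (q : ℚ) + 1 := by ring
  rw [h1q]
  field_simp
  ring

open scoped Classical in
/-- **(k2) The loss bound at `d = q`**: the loss of a member outside layer 0 at its covering set `B ∪ {z}` is
at most `k1/((q+1)² (q+1−k1))`, `k1` the number of layer-0 preimages of that covering set. -/
theorem loss_le_dq {q : ℕ} {G : Finset α} (hG : G ∈ flatsQ M (q + 1)) (hd : (gr M \ G).card = q)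
    {B : Finset α} (hB : B ∈ membersIn M (Uq M (q + 2) q) G) (hB0 : B ∉ lay0 M q G) {z : α}
    (hz : z ∈ G \ clF M B) :
    loss M q G B z ≤
      (k1 M q G (insert z B) : ℚ) / ((((q : ℚ) + 1) ^ 2) * (((q : ℚ) + 1) - (k1 M q G (insert z B) : ℚ))) := by
  have hS : insert z B ∈ shadowAt M (q + 2) q (Uq M (q + 2) q) G := insert_mem_shadowAt (Finset.Subset.refl _) hG hB hz
  have hSG : insert z B ⊆ G := subset_of_mem_shadowAt hS
  have hk_nat : k1 M q G (insert z B) ≤ q := hd ▸ k1_le hG hSG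
  set S := insert z B with hSdef
  set k := k1 M q G S with hkdef
  have hq1 : (0 : ℚ) < (q : ℚ) + 1 := by positivity
  have hqk : (0 : ℚ) < ((q : ℚ) + 1) - (k : ℚ) := by
    have : (k : ℚ) ≤ (q : ℚ) := by exact_mod_cast hk_nat
    linarith
  have hrhs : 0 ≤ (k : ℚ) / ((((q : ℚ) + 1) ^ 2) * (((q : ℚ) + 1) - (k : ℚ))) := by positivity
  have hcapS : capS M q G S = 1 - (k : ℚ) * phiQ q / (1 + (q : ℚ)) := by
    unfold capS; rw [hd]
  have hcap0 : 0 ≤ capS M q G S := capS_nonneg hG hd.le hSG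
  have hreq : req M q B ≤ 1 / ((q : ℚ) + 1) := req_le_dq hG hd hB hB0
  have hL1 : L1 M q G S ≤ (((q : ℚ) + 1) - (k : ℚ)) / ((q : ℚ) + 1) := L1_le_dq hG hd hS
  unfold loss fS
  split_ifs with hle
  · rw [sub_self, mul_zero]; exact hrhs
  · push Not at hle
    have hLpos : 0 < L1 M q G S := hcap0.trans_lt hle
    have h1 : 1 - capS M q G S / L1 M q G S = (L1 M q G S - capS M q G S) / L1 M q G S := by
      field_simp
    rw [h1]
    calc req M q B * ((L1 M q G S - capS M q G S) / L1 M q G S)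
        ≤ (1 / ((q : ℚ) + 1)) * ((L1 M q G S - capS M q G S) / L1 M q G S) := by
          apply mul_le_mul_of_nonneg_right hreq
          exact div_nonneg (by linarith) hLpos.le
      _ ≤ (1 / ((q : ℚ) + 1)) *
          ((((((q : ℚ) + 1) - (k : ℚ)) / ((q : ℚ) + 1)) - capS M q G S) / ((((q : ℚ) + 1) - (k : ℚ)) / ((q : ℚ) + 1))) := by
          apply mul_le_mul_of_nonneg_left _ (by positivity)
          exact ratio_mono hcap0 hLpos hL1
      _ = (k : ℚ) / ((((q : ℚ) + 1) ^ 2) * (((q : ℚ) + 1) - (k : ℚ))) := by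
          rw [hcapS, ← mul_div_assoc]; exact loss_arith hk_nat

open scoped Classical in
/-- At `d = q`, `L1 S ≤ (κ₀(S) − k1 S)/(q + 1)` at every shadow set, `κ₀(S)` the number of coloops of `S`. -/
theorem L1_le_coloops_dq {q : ℕ} {G : Finset α} (hG : G ∈ flatsQ M (q + 1)) (hd : (gr M \ G).card = q)
    (S : Finset α) :
    L1 M q G S ≤ (((coloops M S).card : ℚ) - (k1 M q G S : ℚ)) / ((q : ℚ) + 1) := by
  unfold L1
  have hle : ∀ B ∈ (coverPreimages M (Uq M (q + 2) q) G S).filter (fun B => B ∉ lay0 M q G),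
      req M q B ≤ 1 / ((q : ℚ) + 1) := by
    intro B hB
    rw [Finset.mem_filter, mem_coverPreimages] at hB
    exact req_le_dq hG hd hB.1.1 hB.2
  have hcount : ((coverPreimages M (Uq M (q + 2) q) G S).filter (fun B => B ∉ lay0 M q G)).card + k1 M q G S ≤
      (coloops M S).card := by
    unfold k1
    rw [add_comm, Finset.card_filter_add_card_filter_not]
    exact card_coverPreimages_le_card_coloops (Finset.Subset.refl _) G S
  calc ∑ B ∈ (coverPreimages M (Uq M (q + 2) q) G S).filter (fun B => B ∉ lay0 M q G), req M q B
      ≤ ∑ _B ∈ (coverPreimages M (Uq M (q + 2) q) G S).filter (fun B => B ∉ lay0 M q G),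
          (1 : ℚ) / ((q : ℚ) + 1) := Finset.sum_le_sum hle
    _ = (((coverPreimages M (Uq M (q + 2) q) G S).filter (fun B => B ∉ lay0 M q G)).card : ℚ) *
          (1 / ((q : ℚ) + 1)) := by rw [Finset.sum_const, nsmul_eq_mul]
    _ ≤ (((coloops M S).card : ℚ) - (k1 M q G S : ℚ)) * (1 / ((q : ℚ) + 1)) := by
        apply mul_le_mul_of_nonneg_right _ (by positivity)
        have h' : (((coverPreimages M (Uq M (q + 2) q) G S).filter (fun B => B ∉ lay0 M q G)).card : ℚ) +
            (k1 M q G S : ℚ) ≤ ((coloops M S).card : ℚ) := by exact_mod_cast hcount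
        linarith
    _ = (((coloops M S).card : ℚ) - (k1 M q G S : ℚ)) / ((q : ℚ) + 1) := by ring

open scoped Classical in
/-- **(k4) The residual capacity at `d = q`**: `cap2 S ≥ ((q+1)(q+1−κ₀(S)) − k1 S)/(q+1)²`. -/
theorem cap2_ge_dq {q : ℕ} {G : Finset α} (hG : G ∈ flatsQ M (q + 1)) (hd : (gr M \ G).card = q)
    {S : Finset α} (hS : S ∈ shadowAt M (q + 2) q (Uq M (q + 2) q) G) :
    ((((q : ℚ) + 1) * (((q : ℚ) + 1) - ((coloops M S).card : ℚ)) - (k1 M q G S : ℚ)) / (((q : ℚ) + 1) ^ 2)) ≤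
      cap2 M q G S := by
  have hSG : S ⊆ G := subset_of_mem_shadowAt hS
  have hcap0 : 0 ≤ capS M q G S := capS_nonneg hG hd.le hSG
  have hL1 := L1_le_coloops_dq hG hd S
  have hcapS : capS M q G S = 1 - (k1 M q G S : ℚ) * phiQ q / (1 + (q : ℚ)) := by unfold capS; rw [hd]
  have hf : fS M q G S * L1 M q G S ≤ L1 M q G S := by
    have := fS_le_one hcap0
    have hL := L1_nonneg (M := M) q G S
    nlinarith
  unfold cap2
  have hq : (0 : ℚ) < (q : ℚ) + 1 := by positivity
  have key : (((q : ℚ) + 1) * (((q : ℚ) + 1) - ((coloops M S).card : ℚ)) - (k1 M q G S : ℚ)) / (((q : ℚ) + 1) ^ 2) =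
      (1 - (k1 M q G S : ℚ) * phiQ q / (1 + (q : ℚ))) -
        (((coloops M S).card : ℚ) - (k1 M q G S : ℚ)) / ((q : ℚ) + 1) := by
    unfold phiQ
    have h1q : (1 : ℚ) + (q : ℚ) = (q : ℚ) + 1 := by ring
    rw [h1q]
    field_simp
    ring
  rw [key, ← hcapS]
  linarith


omit [DecidableEq α] [M.Finite] in
/-- **(k5) The concave inequality**: for `k ≤ a ≤ q` with `2k ≤ (q+1−k)²`,
`(q+2−a)(q+1−a) k ≤ (q+1−k) ((q+1)(q+1−a) − k)`. -/
theorem ineq_k5 {q k a : ℕ} (hka : k ≤ a) (haq : a ≤ q) (hk : 2 * k ≤ (q + 1 - k) ^ 2) :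
    ((q : ℚ) + 2 - (a : ℚ)) * ((q : ℚ) + 1 - (a : ℚ)) * (k : ℚ) ≤
      ((q : ℚ) + 1 - (k : ℚ)) * (((q : ℚ) + 1) * ((q : ℚ) + 1 - (a : ℚ)) - (k : ℚ)) := by
  have hka' : (k : ℚ) ≤ (a : ℚ) := by exact_mod_cast hka
  have haq' : (a : ℚ) ≤ (q : ℚ) := by exact_mod_cast haq
  have hkq : k ≤ q := hka.trans haq
  have hk' : (2 : ℚ) * (k : ℚ) ≤ ((q : ℚ) + 1 - (k : ℚ)) ^ 2 := by
    have h1 : ((q + 1 - k : ℕ) : ℚ) = (q : ℚ) + 1 - (k : ℚ) := by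
      rw [Nat.cast_sub (by omega)]; push_cast; ring
    have h2 : ((2 * k : ℕ) : ℚ) ≤ (((q + 1 - k) ^ 2 : ℕ) : ℚ) := by exact_mod_cast hk
    push_cast at h2
    rw [h1] at h2
    exact h2
  have hpos : (0 : ℚ) < (q : ℚ) + 1 - (k : ℚ) := by linarith
  -- g(x) := (q+1−k)((q+1)(q+1−x) − k) − (q+2−x)(q+1−x)k ; endpoints
  have gk : 0 ≤ ((q : ℚ) + 1 - (k : ℚ)) * (((q : ℚ) + 1) * ((q : ℚ) + 1 - (k : ℚ)) - (k : ℚ)) -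
      ((q : ℚ) + 2 - (k : ℚ)) * ((q : ℚ) + 1 - (k : ℚ)) * (k : ℚ) := by
    have : ((q : ℚ) + 1 - (k : ℚ)) * (((q : ℚ) + 1) * ((q : ℚ) + 1 - (k : ℚ)) - (k : ℚ)) -
        ((q : ℚ) + 2 - (k : ℚ)) * ((q : ℚ) + 1 - (k : ℚ)) * (k : ℚ) =
        ((q : ℚ) + 1 - (k : ℚ)) * (((q : ℚ) + 1 - (k : ℚ)) ^ 2 - 2 * (k : ℚ)) := by ring
    rw [this]
    exact mul_nonneg hpos.le (by linarith)
  have gq : 0 ≤ ((q : ℚ) + 1 - (k : ℚ)) * (((q : ℚ) + 1) * ((q : ℚ) + 1 - (q : ℚ)) - (k : ℚ)) -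
      ((q : ℚ) + 2 - (q : ℚ)) * ((q : ℚ) + 1 - (q : ℚ)) * (k : ℚ) := by
    have : ((q : ℚ) + 1 - (k : ℚ)) * (((q : ℚ) + 1) * ((q : ℚ) + 1 - (q : ℚ)) - (k : ℚ)) -
        ((q : ℚ) + 2 - (q : ℚ)) * ((q : ℚ) + 1 - (q : ℚ)) * (k : ℚ) = ((q : ℚ) + 1 - (k : ℚ)) ^ 2 - 2 * (k : ℚ) := by ring
    rw [this]; linarith
  -- (q−k)·g(a) = (q−a)·g(k) + (a−k)·g(q) + k(q−k)(a−k)(q−a)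
  have hid : ((q : ℚ) - (k : ℚ)) *
      (((q : ℚ) + 1 - (k : ℚ)) * (((q : ℚ) + 1) * ((q : ℚ) + 1 - (a : ℚ)) - (k : ℚ)) -
        ((q : ℚ) + 2 - (a : ℚ)) * ((q : ℚ) + 1 - (a : ℚ)) * (k : ℚ)) =
      ((q : ℚ) - (a : ℚ)) * (((q : ℚ) + 1 - (k : ℚ)) * (((q : ℚ) + 1) * ((q : ℚ) + 1 - (k : ℚ)) - (k : ℚ)) -
        ((q : ℚ) + 2 - (k : ℚ)) * ((q : ℚ) + 1 - (k : ℚ)) * (k : ℚ)) +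
      ((a : ℚ) - (k : ℚ)) * (((q : ℚ) + 1 - (k : ℚ)) * (((q : ℚ) + 1) * ((q : ℚ) + 1 - (q : ℚ)) - (k : ℚ)) -
        ((q : ℚ) + 2 - (q : ℚ)) * ((q : ℚ) + 1 - (q : ℚ)) * (k : ℚ)) +
      (k : ℚ) * ((q : ℚ) - (k : ℚ)) * ((a : ℚ) - (k : ℚ)) * ((q : ℚ) - (a : ℚ)) := by ring
  rcases eq_or_lt_of_le hkq with hqk | hqk
  · -- k = q, hence a = q
    have haeq : a = q := le_antisymm haq (hqk ▸ hka)
    subst haeq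
    have : (k : ℚ) = (a : ℚ) := by exact_mod_cast hqk
    rw [this] at gq ⊢
    linarith
  · have hqk' : (0 : ℚ) < (q : ℚ) - (k : ℚ) := by
      have : (k : ℚ) < (q : ℚ) := by exact_mod_cast hqk
      linarith
    have hrhs : 0 ≤ ((q : ℚ) - (a : ℚ)) * (((q : ℚ) + 1 - (k : ℚ)) * (((q : ℚ) + 1) * ((q : ℚ) + 1 - (k : ℚ)) - (k : ℚ)) -
        ((q : ℚ) + 2 - (k : ℚ)) * ((q : ℚ) + 1 - (k : ℚ)) * (k : ℚ)) +
      ((a : ℚ) - (k : ℚ)) * (((q : ℚ) + 1 - (k : ℚ)) * (((q : ℚ) + 1) * ((q : ℚ) + 1 - (q : ℚ)) - (k : ℚ)) -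
        ((q : ℚ) + 2 - (q : ℚ)) * ((q : ℚ) + 1 - (q : ℚ)) * (k : ℚ)) +
      (k : ℚ) * ((q : ℚ) - (k : ℚ)) * ((a : ℚ) - (k : ℚ)) * ((q : ℚ) - (a : ℚ)) := by
      have h1 : 0 ≤ (q : ℚ) - (a : ℚ) := by linarith
      have h2 : 0 ≤ (a : ℚ) - (k : ℚ) := by linarith
      have h3 : 0 ≤ (k : ℚ) * ((q : ℚ) - (k : ℚ)) * ((a : ℚ) - (k : ℚ)) * ((q : ℚ) - (a : ℚ)) := by positivity
      nlinarith [mul_nonneg h1 gk, mul_nonneg h2 gq]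
    rw [← hid] at hrhs
    have := nonneg_of_mul_nonneg_right hrhs hqk'
    linarith


end PercRepro.Shadow
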